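import Summits.AtomisticToContinuum.Crystallization.Theorems.PalmUnimodularRigidityMinimiserShellsCapDefs
import Literature.Probability.PointProcesses.FiniteConfigurationEvents

/-!
# Giry-measurability of the cap event (stub `stub_capEvent`, line `octahedral-annulus-mandate`)

Stub 1b of line `octahedral-annulus-mandate` of crux `MinimiserShells` (stmt-AtomisticToContinuum-9225,
route `PalmUnimodularRigidity`): there is a measurable set `B` of configurations `μ : Measure ℝ³`
(Giry σ-algebra) such that for every FINITE `F ⊆ ℝ³`, `count|F ∈ B ↔ Capped (count|F)`.  The
defect-surcharged transport of the line reads the cap predicate through this proxy.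

Proof.  By the transfer theorem
`Literature.Probability.PointProcesses.exists_measurableSet_count_restrict_mem_iff` (countable
read-out + sorted enumerations + Lusin–Souslin) it suffices that, for every `m`, the cap condition on
injective `m`-tuples `y : Fin m → ℝ³` is Borel.  The atoms of `count|range y` are the `y i`
(`count_restrict_singleton_ne_zero_iff`), so `Capped (count|range y)` is a finite Boolean
combination — over the nearest atom `i₀`, the first-shell index set `I`, the cap atom `j` and a
witness set `J ⊆ I` of four capped shell atoms — of conditions `f y < g y`, `f y ≤ g y`, `y i ≠ 0`
between continuous real functions of `y` (`‖y i‖`, `dist (y i) (y j)`, the mean radius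
`(∑ i ∈ I, ‖y i‖) / #I`): `capped_count_restrict_range_iff`.  Such a set is measurable
(`measurableSet_capTuples`, Mathlib's measurability calculus of propositions).  No definitions are
introduced.
-/

noncomputable section

open MeasureTheory
open scoped ENNReal BigOperators

namespace Summit.AtomisticToContinuum.Crystallization.Theorems.PalmUnimodularRigidityMinimiserShells.CapEvent

open Summit.AtomisticToContinuum.Crystallization.Theorems.MinimiserShells.Negative.Rootedness (E3)
open Summit.AtomisticToContinuum.Crystallization.Theorems.PalmUnimodularRigidityMinimiserShells.Cap (IsNNDist meanNorm Capped)
open Literature.Probability.PointProcesses (exists_measurableSet_count_restrict_mem_iff)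
open Literature.Probability.Process (count_restrict_singleton_ne_zero_iff)

/-! ## Finite sets of atoms along an injective tuple -/

/-- Along an injective tuple `y`, a finite set of atoms cut out of `range y` by a condition `p` is the
image of the index set `{i | p (y i)}`: existence of such a finite set `F` with a further property
`q F` is existence of an index set `I` with `q (I.image y)`. -/
theorem exists_finset_coe_eq_iff {m : ℕ} {y : Fin m → E3} (hy : Function.Injective y) (p : E3 → Prop)
    (q : Finset E3 → Prop) :
    (∃ F : Finset E3, (↑F : Set E3) = {z : E3 | z ∈ Set.range y ∧ p z} ∧ q F) ↔
      ∃ I : Finset (Fin m), (∀ i, i ∈ I ↔ p (y i)) ∧ q (I.image y) := by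
  constructor
  · rintro ⟨F, hF, hq⟩
    obtain ⟨I, -, rfl⟩ : ∃ I : Finset (Fin m), (↑I : Set (Fin m)) ⊆ Set.univ ∧ I.image y = F :=
      Finset.subset_set_image_iff.1 (by rw [Set.image_univ, hF]; exact fun z hz => hz.1)
    refine ⟨I, fun i => ?_, hq⟩
    have h := Set.ext_iff.1 hF (y i)
    rw [Finset.mem_coe, hy.mem_finset_image] at h
    exact h.trans ⟨fun h' => h'.2, fun h' => ⟨⟨i, rfl⟩, h'⟩⟩
  · rintro ⟨I, hI, hq⟩
    refine ⟨I.image y, ?_, hq⟩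
    rw [Finset.coe_image]
    ext z
    constructor
    · rintro ⟨i, hi, rfl⟩
      exact ⟨⟨i, rfl⟩, (hI i).1 hi⟩
    · rintro ⟨⟨i, rfl⟩, hp⟩
      exact ⟨i, (hI i).2 hp, rfl⟩

/-- The mean norm of the image of an index set along an injective tuple. -/
theorem meanNorm_image {m : ℕ} {y : Fin m → E3} (hy : Function.Injective y) (I : Finset (Fin m)) :
    meanNorm (I.image y) = (∑ i ∈ I, ‖y i‖) / I.card := by
  unfold meanNorm
  rw [Finset.sum_image hy.injOn, Finset.card_image_of_injective _ hy]

/-- Filtering the image of an index set along an injective tuple: the count is read on indices. -/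
theorem card_filter_image {m : ℕ} {y : Fin m → E3} (hy : Function.Injective y) (I : Finset (Fin m))
    (q : E3 → Prop) [DecidablePred q] :
    ((I.image y).filter q).card = (I.filter fun i => q (y i)).card := by
  rw [Finset.filter_image, Finset.card_image_of_injective _ hy]

/-- `n ≤ #(I.filter p)` iff some `J ⊆ I` with `n ≤ #J` consists of elements satisfying `p`. -/
theorem le_card_filter_iff {m n : ℕ} (I : Finset (Fin m)) (p : Fin m → Prop) [DecidablePred p] :
    n ≤ (I.filter p).card ↔ ∃ J : Finset (Fin m), J ⊆ I ∧ n ≤ J.card ∧ ∀ i ∈ J, p i := by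
  constructor
  · intro h
    exact ⟨I.filter p, Finset.filter_subset _ _, h, fun i hi => (Finset.mem_filter.1 hi).2⟩
  · rintro ⟨J, hJI, hJ, hp⟩
    exact hJ.trans (Finset.card_le_card fun i hi => Finset.mem_filter.2 ⟨hJI hi, hp i hi⟩)

/-! ## The cap condition on injective tuples -/

/-- **The cap condition read on an injective tuple.**  For injective `y : Fin m → ℝ³`, the atoms of
`count|range y` are the `y i`, and `Capped (count|range y)` unfolds to an explicit condition on the
indices: a nearest nonzero atom `i₀` with `‖y i₀‖ ∈ [17/20, 21/20]`, the first-shell index set `I`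
(`i ∈ I ↔ y i ≠ 0 ∧ ‖y i‖ ≤ 28/25·‖y i₀‖`), a cap atom `j` in the window `(6/5, 8/5)·r̄`
(`r̄ = (∑ i ∈ I, ‖y i‖) / #I`) and four shell indices `J ⊆ I` within `28/25·r̄` of `y j`. -/
theorem capped_count_restrict_range_iff {m : ℕ} {y : Fin m → E3} (hy : Function.Injective y) :
    Capped ((Measure.count : Measure E3).restrict (Set.range y)) ↔
      ∃ i₀ : Fin m, y i₀ ≠ 0 ∧ 17 / 20 ≤ ‖y i₀‖ ∧ ‖y i₀‖ ≤ 21 / 20 ∧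
        (∀ i, y i ≠ 0 → ‖y i₀‖ ≤ ‖y i‖) ∧
          ∃ I : Finset (Fin m), (∀ i, i ∈ I ↔ (y i ≠ 0 ∧ ‖y i‖ ≤ 28 / 25 * ‖y i₀‖)) ∧
            ∃ j : Fin m, 6 / 5 * ((∑ i ∈ I, ‖y i‖) / I.card) < ‖y j‖ ∧
              ‖y j‖ < 8 / 5 * ((∑ i ∈ I, ‖y i‖) / I.card) ∧
                ∃ J : Finset (Fin m), J ⊆ I ∧ 4 ≤ J.card ∧
                  ∀ i ∈ J, dist (y i) (y j) ≤ 28 / 25 * ((∑ i ∈ I, ‖y i‖) / I.card) := by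
  unfold Capped IsNNDist
  simp only [count_restrict_singleton_ne_zero_iff]
  constructor
  · rintro ⟨a, ha1, ha2, ⟨⟨_, ⟨i₀, rfl⟩, h0, rfl⟩, hmin⟩, hF⟩
    obtain ⟨I, hI, _, ⟨j, rfl⟩, hlo, hhi, hcnt⟩ := (exists_finset_coe_eq_iff hy _ _).1 hF
    rw [meanNorm_image hy] at hlo hhi hcnt
    rw [card_filter_image hy, le_card_filter_iff] at hcnt
    exact ⟨i₀, h0, ha1, ha2, fun i hi => hmin _ ⟨i, rfl⟩ hi, I, hI, j, hlo, hhi, hcnt⟩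
  · rintro ⟨i₀, h0, ha1, ha2, hmin, I, hI, j, hlo, hhi, hcnt⟩
    refine ⟨‖y i₀‖, ha1, ha2, ⟨⟨y i₀, ⟨i₀, rfl⟩, h0, rfl⟩, ?_⟩,
      (exists_finset_coe_eq_iff hy _ _).2 ⟨I, hI, y j, ⟨j, rfl⟩, ?_⟩⟩
    · rintro _ ⟨i, rfl⟩ hi
      exact hmin i hi
    · beta_reduce
      rw [meanNorm_image hy, card_filter_image hy, le_card_filter_iff]
      exact ⟨hlo, hhi, hcnt⟩

/-- **The set of tuples satisfying the index form of the cap condition is Borel**: a finite Boolean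
combination (quantifiers over the finite types `Fin m`, `Finset (Fin m)`) of sub- and super-level sets
of continuous real functions of the tuple. -/
theorem measurableSet_capTuples (m : ℕ) :
    MeasurableSet {y : Fin m → E3 | ∃ i₀ : Fin m, y i₀ ≠ 0 ∧ 17 / 20 ≤ ‖y i₀‖ ∧ ‖y i₀‖ ≤ 21 / 20 ∧
      (∀ i, y i ≠ 0 → ‖y i₀‖ ≤ ‖y i‖) ∧
        ∃ I : Finset (Fin m), (∀ i, i ∈ I ↔ (y i ≠ 0 ∧ ‖y i‖ ≤ 28 / 25 * ‖y i₀‖)) ∧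
          ∃ j : Fin m, 6 / 5 * ((∑ i ∈ I, ‖y i‖) / I.card) < ‖y j‖ ∧
            ‖y j‖ < 8 / 5 * ((∑ i ∈ I, ‖y i‖) / I.card) ∧
              ∃ J : Finset (Fin m), J ⊆ I ∧ 4 ≤ J.card ∧
                ∀ i ∈ J, dist (y i) (y j) ≤ 28 / 25 * ((∑ i ∈ I, ‖y i‖) / I.card)} := by
  refine measurableSet_setOf.2 ?_
  simp only [ne_eq]
  fun_prop

/-- **The cap condition on injective tuples is Borel**: for every `m` some measurable
`G ⊆ (Fin m → ℝ³)` agrees with `Capped (count|range y)` on injective `y` (the hypothesis of the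
transfer theorem `exists_measurableSet_count_restrict_mem_iff`). -/
theorem exists_measurableSet_capped (m : ℕ) :
    ∃ G : Set (Fin m → E3), MeasurableSet G ∧ ∀ y : Fin m → E3, Function.Injective y →
      (Capped ((Measure.count : Measure E3).restrict (Set.range y)) ↔ y ∈ G) :=
  ⟨_, measurableSet_capTuples m, fun _ hy => capped_count_restrict_range_iff hy⟩

/-! ## The stub -/

/-- **stub_capEvent** (stub 1b of line `octahedral-annulus-mandate`, crux `MinimiserShells`):
Giry-measurability of the cap event on finite configurations — some measurable set `B` of measures
on `ℝ³` satisfies `count|F ∈ B ↔ Capped (count|F)` for every finite `F ⊆ ℝ³`.  It is the set provided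
by the transfer theorem `exists_measurableSet_count_restrict_mem_iff` for the property
`Q F := Capped (count|F)`, whose tuple form is Borel by `exists_measurableSet_capped`. -/
theorem stub_capEvent :
    ∃ B : Set (Measure E3), MeasurableSet B ∧ ∀ F : Set E3, F.Finite →
      ((Measure.count : Measure E3).restrict F ∈ B ↔ Capped ((Measure.count : Measure E3).restrict F)) :=
  exists_measurableSet_count_restrict_mem_iff
    (Q := fun F : Set E3 => Capped ((Measure.count : Measure E3).restrict F)) exists_measurableSet_capped

end Summit.AtomisticToContinuum.Crystallization.Theorems.PalmUnimodularRigidityMinimiserShells.CapEvent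

end
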